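import Summits.Ventures.PercRepro.Night2FatDegSideB
import Summits.Ventures.PercRepro.Night2FatDegCountB
import Summits.Ventures.PercRepro.Night2FatDegComb
import Summits.Ventures.PercRepro.Night2FatZCross

/-!
# night-2: the singly degenerate regime at small `N` — the fair share from explicit sets

Given, for a lossy basis pair of the singly degenerate regime, a set `U` of side points of `W ∖ {x}`, a set `V` of
FREE points (off `clF M`, on no class basis line coplanar with `M`) and a set `E` of points on no NON-class basis
line, the targets `Q ∪ {x} ∪ Y` with `Y` meeting `U` and `V` are unloaded (`dload_eq_zero_of_side_free_deg`), the
targets `Q ∪ {x, y}` with `y ∈ E` are unloaded (`dload_eq_zero_of_singleton_of_class`), and — when the line of `M` is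
not a non-class basis line — so are the targets whose `Y` contains two side points
(`dload_eq_zero_of_two_side_points_deg'`).  With the counts `choose_le_card_filter_meets_both` (family B1) and
`choose_le_card_filter_side_family` (family B2) this gives the fair share from a NUMERIC hypothesis on
`(|U|, |V|, |E|)`: **`basis_pair_fair_fat_deg_of_sets_B1`**, **`basis_pair_fair_fat_deg_of_sets_B2`**.
Paper `proofs/NIGHT-2-g35.md` §5.
-/

namespace PercRepro.Shadow

open PercRepro.ThmH PercRepro.PerFlat

variable {α : Type*} [DecidableEq α] {M : Matroid α} [M.Finite] {G : Finset α}

/-- **Family B1 (a side point and a free point) with unloaded singletons.** -/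
theorem basis_pair_fair_fat_deg_of_sets_B1 (hG : G ∈ flatsQ M (5 + 1)) (hd : (gr M \ G).card = 2)
    (hk : kColoops M G = 1) (hs : ∀ e ∈ gr M, ∀ f ∈ gr M, e ≠ f → rkN M {e, f} = 2)
    (hl : ∀ e ∈ gr M, M.Indep {e}) (hfat : (fatClosures M 5 G 2).card ≤ 1) {B₀ : Finset α}
    (hB₀ : B₀ ∈ thinMembers M 5 G) {w₀ x : α} (hD : G \ clF M B₀ = {w₀, x}) (hne : w₀ ≠ x) {R₁ : Finset α}
    (hR₁V : R₁ ⊆ (G \ coloops M G) \ {w₀, x}) (hR₁2 : rkN M R₁ = 2) (hR₁3 : 3 ≤ R₁.card) {c₂ c₃ : α}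
    (hc₂V : c₂ ∈ (G \ coloops M G) \ {w₀, x}) (hc₃V : c₃ ∈ (G \ coloops M G) \ {w₀, x})
    (hc₂ : c₂ ∉ clF M R₁) (hc₃ : c₃ ∉ clF M (insert c₂ R₁))
    (hcover : ∀ e ∈ (G \ coloops M G) \ {w₀, x}, e ∈ clF M (insert c₂ R₁) ∨ e ∈ clF M (insert c₃ R₁))
    (hnd₂ : 3 ≤ rkN M (((G \ coloops M G) \ {w₀, x}).filter
      (fun e => e ∈ clF M (insert c₂ R₁) ∧ e ∉ clF M R₁)))
    {B : Finset α} (hB : B ∈ thinMembers M 5 G) (hnP : ¬ bigP M G B) {z : α} (hz : z ∈ G \ clF M B)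
    (hl0 : loss M 5 G B z ≠ 0) (hw₀ : w₀ ∈ insert z B) (hx : x ∉ insert z B) (hN3 : 3 ≤ (G \ insert z B).card)
    {U V E : Finset α} (hU : U ⊆ (G \ insert z B).erase x)
    (hUs : ∀ y ∈ U, y ∈ clF M (insert c₃ R₁) ∧ y ∉ clF M R₁) (hV : V ⊆ (G \ insert z B).erase x)
    (hVf : ∀ f ∈ V, f ∉ clF M (((G \ coloops M G) \ {w₀, x}).filter
        (fun e => e ∈ clF M (insert c₃ R₁) ∧ e ∉ clF M R₁)) ∧
      ∀ a ∈ (insert z B \ coloops M G).erase w₀, ∀ b ∈ (insert z B \ coloops M G).erase w₀, a ≠ b →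
        f ∈ clF M {a, b} → rkN M (insert w₀ (insert x {a, b})) ≤ 3 →
        4 ≤ rkN M ({a, b} ∪ ((G \ coloops M G) \ {w₀, x}).filter
          (fun e => e ∈ clF M (insert c₃ R₁) ∧ e ∉ clF M R₁)))
    (hE : E ⊆ (G \ insert z B).erase x)
    (hEc : ∀ y ∈ E, ∀ a ∈ (insert z B \ coloops M G).erase w₀, ∀ b ∈ (insert z B \ coloops M G).erase w₀, a ≠ b →
      y ∈ clF M {a, b} → rkN M (insert w₀ (insert x {a, b})) ≤ 3)
    (hnum : ∀ s : ℕ → ℕ, (∀ j, 3 ≤ j → j ≤ (G \ insert z B).card →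
        ((G \ insert z B).card - 1).choose (j - 1) + ((G \ insert z B).card - 1 - U.card - V.card).choose (j - 1) ≤
          s j + ((G \ insert z B).card - 1 - U.card).choose (j - 1) +
            ((G \ insert z B).card - 1 - V.card).choose (j - 1)) →
      (1 : ℚ) ≤ fatTerm 1 (if (G \ insert z B).card - 1 ≤ 3 then 1 else 11 / 18) +
        (E.card : ℚ) * fatTerm 2 (if (G \ insert z B).card - 2 ≤ 3 then 1 else 11 / 18) +
        ∑ j ∈ Finset.Icc 3 (G \ insert z B).card,
          ((s j : ℕ) : ℚ) * fatTerm j (if (G \ insert z B).card - j ≤ 3 then 1 else 11 / 18)) :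
    loss M 5 G B z ≤ rhoL M 5 G B z * lossIncomeH M 5 G (bigP M G) (dshGT2 M 5 G) B z := by
  have hxG : x ∈ G \ insert z B := by
    refine Finset.mem_sdiff.2 ⟨?_, hx⟩
    have : x ∈ G \ clF M B₀ := by
      rw [hD]
      exact Finset.mem_insert_of_mem (Finset.mem_singleton_self _)
    exact (Finset.mem_sdiff.1 this).1
  set W' := (G \ insert z B).erase x with hW'
  have hW'c : W'.card + 1 = (G \ insert z B).card := by
    rw [hW', Finset.card_erase_of_mem hxG]
    have : 0 < (G \ insert z B).card := Finset.card_pos.2 ⟨x, hxG⟩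
    omega
  set P : Finset α → Prop := fun Y => (Y ∩ U).Nonempty ∧ (Y ∩ V).Nonempty with hP
  apply basis_pair_fair_of_family_and_singletons hG hd hk hs hl hfat hB₀ hD hne hB hnP hz hl0 hw₀ hx hN3 P
  · intro T hT hxT _ hPY
    obtain ⟨⟨u, hu⟩, ⟨f, hf⟩⟩ := hPY
    rw [Finset.mem_inter] at hu hf
    exact dload_eq_zero_of_side_free_deg hG hd hk hs hl hfat hB₀ hD hne hR₁V hR₁2 hR₁3 hc₂V hc₃V hc₂ hc₃ hcover
      hnd₂ hB hnP hz hw₀ hx hT hxT hu.1 (hUs u hu.2).1 (hUs u hu.2).2 hf.1 (hVf f hf.2).1 (hVf f hf.2).2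
  · exact hE
  · intro T hT hxT hT2 hYE
    -- the unique point of `Y` is in `E`
    have hxTQ : x ∈ T \ insert z B := Finset.mem_sdiff.2 ⟨hxT, hx⟩
    have hY1 : ((T \ insert z B).erase x).card = 1 := by
      rw [Finset.card_erase_of_mem hxTQ, hT2]
    obtain ⟨y, hy⟩ := Finset.card_eq_one.1 hY1
    have hyY : y ∈ (T \ insert z B).erase x := by rw [hy]; exact Finset.mem_singleton_self y
    exact dload_eq_zero_of_singleton_of_class hG hd hk hs hl hfat hB₀ hD hne hB hnP hz hw₀ hx hT hxT hT2 hyY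
      (hEc y (hYE hyY))
  · apply hnum
    intro j hj3 hjN
    have := choose_le_card_filter_meets_both W' U V (j - 1)
    have hUV : (W' \ (U ∪ V)).card = W'.card - U.card - V.card := by
      rw [Finset.card_sdiff_of_subset (Finset.union_subset hU hV)]
      rw [Finset.card_union_of_disjoint]
      · omega
      · rw [Finset.disjoint_left]
        intro y hyU hyV
        have hyM : y ∈ clF M (((G \ coloops M G) \ {w₀, x}).filter
            (fun e => e ∈ clF M (insert c₃ R₁) ∧ e ∉ clF M R₁)) := by
          have hGg : G ⊆ gr M := (mem_flatsQ.1 hG).1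
          have hd' : (gr M \ G).card ≤ 5 := by omega
          have hKQ : coloops M G ⊆ insert z B :=
            (coloops_subset_of_mem_thinMembers hG hd' hB).trans (Finset.subset_insert _ _)
          have hyW := hU hyU
          have hyx : y ≠ x := (Finset.mem_erase.1 hyW).1
          have hyTQ : y ∈ G \ insert z B := Finset.mem_of_mem_erase hyW
          have hyV' : y ∈ (G \ coloops M G) \ {w₀, x} := by
            rw [Finset.mem_sdiff, Finset.mem_sdiff, Finset.mem_insert, Finset.mem_singleton]
            refine ⟨⟨(Finset.mem_sdiff.1 hyTQ).1, fun h => (Finset.mem_sdiff.1 hyTQ).2 (hKQ h)⟩, ?_⟩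
            rintro (rfl | rfl)
            · exact (Finset.mem_sdiff.1 hyTQ).2 hw₀
            · exact hyx rfl
          exact subset_clF_of_subset_gr (fun e he => hGg (Finset.mem_sdiff.1 (Finset.mem_sdiff.1
            (Finset.mem_filter.1 he).1).1).1) (Finset.mem_filter.2 ⟨hyV', hUs y hyU⟩)
        exact (hVf y hyV).1 hyM
    rw [hUV, Finset.card_sdiff_of_subset hU, Finset.card_sdiff_of_subset hV] at this
    rw [show (G \ insert z B).card - 1 = W'.card by omega]
    exact this

/-- **Family B2 (B1 plus two side points) with unloaded singletons**, when the line of `M` is not a non-class basis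
line. -/
theorem basis_pair_fair_fat_deg_of_sets_B2 (hG : G ∈ flatsQ M (5 + 1)) (hd : (gr M \ G).card = 2)
    (hk : kColoops M G = 1) (hs : ∀ e ∈ gr M, ∀ f ∈ gr M, e ≠ f → rkN M {e, f} = 2)
    (hl : ∀ e ∈ gr M, M.Indep {e}) (hfat : (fatClosures M 5 G 2).card ≤ 1) {B₀ : Finset α}
    (hB₀ : B₀ ∈ thinMembers M 5 G) {w₀ x : α} (hD : G \ clF M B₀ = {w₀, x}) (hne : w₀ ≠ x) {R₁ : Finset α}
    (hR₁V : R₁ ⊆ (G \ coloops M G) \ {w₀, x}) (hR₁2 : rkN M R₁ = 2) (hR₁3 : 3 ≤ R₁.card) {c₂ c₃ : α}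
    (hc₂V : c₂ ∈ (G \ coloops M G) \ {w₀, x}) (hc₃V : c₃ ∈ (G \ coloops M G) \ {w₀, x})
    (hc₂ : c₂ ∉ clF M R₁) (hc₃ : c₃ ∉ clF M (insert c₂ R₁))
    (hcover : ∀ e ∈ (G \ coloops M G) \ {w₀, x}, e ∈ clF M (insert c₂ R₁) ∨ e ∈ clF M (insert c₃ R₁))
    (hnd₂ : 3 ≤ rkN M (((G \ coloops M G) \ {w₀, x}).filter
      (fun e => e ∈ clF M (insert c₂ R₁) ∧ e ∉ clF M R₁)))
    {B : Finset α} (hB : B ∈ thinMembers M 5 G) (hnP : ¬ bigP M G B) {z : α} (hz : z ∈ G \ clF M B)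
    (hl0 : loss M 5 G B z ≠ 0) (hw₀ : w₀ ∈ insert z B) (hx : x ∉ insert z B) (hN3 : 3 ≤ (G \ insert z B).card)
    (hM : ¬ (4 ≤ rkN M (insert w₀ (insert x (((G \ coloops M G) \ {w₀, x}).filter
        (fun e => e ∈ clF M (insert c₃ R₁) ∧ e ∉ clF M R₁)))) ∧
      ∃ a ∈ (insert z B \ coloops M G).erase w₀, ∃ b ∈ (insert z B \ coloops M G).erase w₀, a ≠ b ∧
        a ∈ clF M (((G \ coloops M G) \ {w₀, x}).filter
          (fun e => e ∈ clF M (insert c₃ R₁) ∧ e ∉ clF M R₁)) ∧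
        b ∈ clF M (((G \ coloops M G) \ {w₀, x}).filter
          (fun e => e ∈ clF M (insert c₃ R₁) ∧ e ∉ clF M R₁))))
    {U V E : Finset α} (hU : U ⊆ (G \ insert z B).erase x)
    (hUs : ∀ y ∈ U, y ∈ clF M (insert c₃ R₁) ∧ y ∉ clF M R₁) (hV : V ⊆ (G \ insert z B).erase x)
    (hVf : ∀ f ∈ V, f ∉ clF M (((G \ coloops M G) \ {w₀, x}).filter
        (fun e => e ∈ clF M (insert c₃ R₁) ∧ e ∉ clF M R₁)) ∧
      ∀ a ∈ (insert z B \ coloops M G).erase w₀, ∀ b ∈ (insert z B \ coloops M G).erase w₀, a ≠ b →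
        f ∈ clF M {a, b} → rkN M (insert w₀ (insert x {a, b})) ≤ 3 →
        4 ≤ rkN M ({a, b} ∪ ((G \ coloops M G) \ {w₀, x}).filter
          (fun e => e ∈ clF M (insert c₃ R₁) ∧ e ∉ clF M R₁)))
    (hE : E ⊆ (G \ insert z B).erase x)
    (hEc : ∀ y ∈ E, ∀ a ∈ (insert z B \ coloops M G).erase w₀, ∀ b ∈ (insert z B \ coloops M G).erase w₀, a ≠ b →
      y ∈ clF M {a, b} → rkN M (insert w₀ (insert x {a, b})) ≤ 3)
    (hnum : ∀ s : ℕ → ℕ, (∀ j, 3 ≤ j → j ≤ (G \ insert z B).card →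
        ((G \ insert z B).card - 1).choose (j - 1) ≤
          s j + ((G \ insert z B).card - 1 - U.card).choose (j - 1) +
            U.card * ((G \ insert z B).card - 1 - U.card - V.card).choose (j - 1 - 1)) →
      (1 : ℚ) ≤ fatTerm 1 (if (G \ insert z B).card - 1 ≤ 3 then 1 else 11 / 18) +
        (E.card : ℚ) * fatTerm 2 (if (G \ insert z B).card - 2 ≤ 3 then 1 else 11 / 18) +
        ∑ j ∈ Finset.Icc 3 (G \ insert z B).card,
          ((s j : ℕ) : ℚ) * fatTerm j (if (G \ insert z B).card - j ≤ 3 then 1 else 11 / 18)) :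
    loss M 5 G B z ≤ rhoL M 5 G B z * lossIncomeH M 5 G (bigP M G) (dshGT2 M 5 G) B z := by
  have hxG : x ∈ G \ insert z B := by
    refine Finset.mem_sdiff.2 ⟨?_, hx⟩
    have : x ∈ G \ clF M B₀ := by
      rw [hD]
      exact Finset.mem_insert_of_mem (Finset.mem_singleton_self _)
    exact (Finset.mem_sdiff.1 this).1
  set W' := (G \ insert z B).erase x with hW'
  have hW'c : W'.card + 1 = (G \ insert z B).card := by
    rw [hW', Finset.card_erase_of_mem hxG]
    have : 0 < (G \ insert z B).card := Finset.card_pos.2 ⟨x, hxG⟩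
    omega
  have hGg : G ⊆ gr M := (mem_flatsQ.1 hG).1
  have hd' : (gr M \ G).card ≤ 5 := by omega
  have hKQ : coloops M G ⊆ insert z B :=
    (coloops_subset_of_mem_thinMembers hG hd' hB).trans (Finset.subset_insert _ _)
  have hsideM : ∀ y ∈ U, y ∈ clF M (((G \ coloops M G) \ {w₀, x}).filter
      (fun e => e ∈ clF M (insert c₃ R₁) ∧ e ∉ clF M R₁)) := by
    intro y hyU
    have hyW := hU hyU
    have hyx : y ≠ x := (Finset.mem_erase.1 hyW).1
    have hyTQ : y ∈ G \ insert z B := Finset.mem_of_mem_erase hyW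
    have hyV' : y ∈ (G \ coloops M G) \ {w₀, x} := by
      rw [Finset.mem_sdiff, Finset.mem_sdiff, Finset.mem_insert, Finset.mem_singleton]
      refine ⟨⟨(Finset.mem_sdiff.1 hyTQ).1, fun h => (Finset.mem_sdiff.1 hyTQ).2 (hKQ h)⟩, ?_⟩
      rintro (rfl | rfl)
      · exact (Finset.mem_sdiff.1 hyTQ).2 hw₀
      · exact hyx rfl
    exact subset_clF_of_subset_gr (fun e he => hGg (Finset.mem_sdiff.1 (Finset.mem_sdiff.1
      (Finset.mem_filter.1 he).1).1).1) (Finset.mem_filter.2 ⟨hyV', hUs y hyU⟩)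
  have hUV : Disjoint U V := by
    rw [Finset.disjoint_left]
    intro y hyU hyV
    exact (hVf y hyV).1 (hsideM y hyU)
  set P : Finset α → Prop := fun Y => (Y ∩ U).Nonempty ∧ ((Y ∩ V).Nonempty ∨ 2 ≤ (Y ∩ U).card) with hP
  apply basis_pair_fair_of_family_and_singletons hG hd hk hs hl hfat hB₀ hD hne hB hnP hz hl0 hw₀ hx hN3 P
  · intro T hT hxT _ hPY
    obtain ⟨⟨u, hu⟩, hrest⟩ := hPY
    rw [Finset.mem_inter] at hu
    rcases hrest with ⟨f, hf⟩ | h2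
    · rw [Finset.mem_inter] at hf
      exact dload_eq_zero_of_side_free_deg hG hd hk hs hl hfat hB₀ hD hne hR₁V hR₁2 hR₁3 hc₂V hc₃V hc₂ hc₃ hcover
        hnd₂ hB hnP hz hw₀ hx hT hxT hu.1 (hUs u hu.2).1 (hUs u hu.2).2 hf.1 (hVf f hf.2).1 (hVf f hf.2).2
    · obtain ⟨u', hu', huu'⟩ := Finset.exists_mem_ne h2 u
      rw [Finset.mem_inter] at hu'
      exact dload_eq_zero_of_two_side_points_deg' hG hd hk hs hl hfat hB₀ hD hne hR₁V hR₁2 hR₁3 hc₂V hc₃V hc₂ hc₃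
        hcover hnd₂ hB hnP hz hw₀ hx hM hT hxT hu.1 (hUs u hu.2).1 (hUs u hu.2).2 hu'.1 (hUs u' hu'.2).1
        (hUs u' hu'.2).2 (Ne.symm huu')
  · exact hE
  · intro T hT hxT hT2 hYE
    have hxTQ : x ∈ T \ insert z B := Finset.mem_sdiff.2 ⟨hxT, hx⟩
    have hY1 : ((T \ insert z B).erase x).card = 1 := by
      rw [Finset.card_erase_of_mem hxTQ, hT2]
    obtain ⟨y, hy⟩ := Finset.card_eq_one.1 hY1
    have hyY : y ∈ (T \ insert z B).erase x := by rw [hy]; exact Finset.mem_singleton_self y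
    exact dload_eq_zero_of_singleton_of_class hG hd hk hs hl hfat hB₀ hD hne hB hnP hz hw₀ hx hT hxT hT2 hyY
      (hEc y (hYE hyY))
  · apply hnum
    intro j hj3 hjN
    have := choose_le_card_filter_side_family W' U V hU hV hUV (j - 1)
    rw [show (G \ insert z B).card - 1 = W'.card by omega]
    exact this

end PercRepro.Shadow
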